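import Literature.AnabelianGeometry.AbsoluteAnabelian.AbsTopISemiAbsolute
import Literature.AnabelianGeometry.AbsoluteAnabelian.AbsTopIThm26iProofs
import HarnessLib

/-!
# [AbsTopI] Thm 2.6 (i) ⟹ "`Δ ⊆ Π` is group-theoretic": isomorphisms `Π₁ ≅ Π₂` preserve `Δ`

S. Mochizuki, *Topics in Absolute Anabelian Geometry I: Generalities* (2012) [AbsTopI], Thm 2.6
(i), manuscript p. 21 (lit key `paper:url-11ac98ba15fc`): "the kernel of the quotient `Π ↠ G` may
be characterized ["group-theoretically"] as the kernel of the quotient `Π ↠ Π^{ab-t}`".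

Proof-only companion (no definitions, no named facts) of abc-iut-L4-t4's `AbsTopISemiAbsolute.lean`.
The typed predicate `E.Thm26i` records this characterization as
`Δ = ⨅_l ⨅_{φ : Π →ₜ* ℤ_l} Ker φ`; HERE its USE is kernel-checked: if two extensions `E`, `F` both
satisfy the characterization clause, every isomorphism of topological groups `φ : Π_E ⥲ Π_F` carries
`Δ_E` onto `Δ_F` (`PreservesGeom φ`, abc-iut-L4-t4's [AbsAnab] Lemma 1.3.8 predicate) — the form
in which [AbsTopI] Thm 2.14 (i) ("`φ` induces `Δ₁ ≅ Δ₂`") and [IUTchI–II] ("`Δ ⊆ Π` may be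
reconstructed group-theoretically") consume Thm 2.6.  Sibling files: `AbsTopIThm26ivProofs`
(`preservesGeom_of_thm26iv`, abc-iut-w5-d206), `AbsTopII/Remark332Proofs` (abc-iut-L4-t6).
HONEST FRAMING: [AbsTopI] is refereed and undisputed; nothing here bears on [IUTchIII] Cor. 3.12.
-/

noncomputable section

open Topology

namespace Literature.AnabelianGeometry.AbsoluteAnabelian

namespace FundamentalExtension

universe u

variable {E F : FundamentalExtension.{u}}

/-- The characterization clause of Thm 2.6 (i) (`Δ` = the common kernel of the continuous
`Π → ℤ_l`) contains "every continuous `Π → ℤ_l` kills `Δ`" (i.e. "`Π^{ab-t} ↠ G^{ab-t}` is an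
isomorphism"). [cite: MochizukiAbsTopI2012, Thm 2.6 (i) p.21] -/
theorem geom_le_ker_of_eq_iInf_ker
    (hE : E.geom = ⨅ (l : ℕ) (_ : Fact l.Prime) (ψ : E.arith →ₜ* Multiplicative ℤ_[l]),
      ψ.toMonoidHom.ker)
    (l : ℕ) [hl : Fact l.Prime] (ψ : E.arith →ₜ* Multiplicative ℤ_[l]) :
    E.geom ≤ ψ.toMonoidHom.ker := by
  intro x hx
  rw [hE] at hx
  exact Subgroup.mem_iInf.mp (Subgroup.mem_iInf.mp (Subgroup.mem_iInf.mp hx l) hl) ψ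

/-- If `Δ_F` is the common kernel of the continuous `Π_F → ℤ_l` (the characterization clause of
Thm 2.6 (i) for `F`) and every continuous `Π_E → ℤ_l` kills `Δ_E`, then every isomorphism
`φ : Π_E ⥲ Π_F` maps `Δ_E` into `Δ_F` (pull the characters of `Π_F` back along `φ`).
[cite: MochizukiAbsTopI2012, Thm 2.6 (i) p.21] -/
theorem geom_map_le_of_eq_iInf_ker
    (hE : ∀ (l : ℕ) [Fact l.Prime] (ψ : E.arith →ₜ* Multiplicative ℤ_[l]),
      E.geom ≤ ψ.toMonoidHom.ker)
    (hF : F.geom = ⨅ (l : ℕ) (_ : Fact l.Prime) (ψ : F.arith →ₜ* Multiplicative ℤ_[l]),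
      ψ.toMonoidHom.ker)
    (φ : E.arith ≃ₜ* F.arith) : E.geom.map φ.toMulEquiv.toMonoidHom ≤ F.geom := by
  rintro _ ⟨x, hx, rfl⟩
  rw [hF]
  refine Subgroup.mem_iInf.mpr fun l => Subgroup.mem_iInf.mpr fun hl => ?_
  refine Subgroup.mem_iInf.mpr fun ψ => ?_
  -- the character `ψ ∘ φ` of `Π_E` kills `Δ_E`
  let ψ' : E.arith →ₜ* Multiplicative ℤ_[l] :=
    ⟨ψ.toMonoidHom.comp φ.toMulEquiv.toMonoidHom, ψ.continuous_toFun.comp φ.continuous⟩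
  have h1 := hE l ψ' hx
  rw [MonoidHom.mem_ker] at h1 ⊢
  exact h1

/-- **[AbsTopI] Thm 2.6 (i) ⟹ `Δ ⊆ Π` is preserved by isomorphisms** ("the kernel of the quotient
`Π ↠ G` may be characterized group-theoretically as the kernel of `Π ↠ Π^{ab-t}`"): if `E` and `F`
both satisfy the typed Thm 2.6 (i) (`Thm26i`; only its characterization clause is used), every
isomorphism of topological groups `φ : Π_E ⥲ Π_F` carries `Δ_E` onto `Δ_F`.
[cite: MochizukiAbsTopI2012, Thm 2.6 (i) p.21] -/
theorem preservesGeom_of_thm26i (hE : E.Thm26i) (hF : F.Thm26i) (φ : E.arith ≃ₜ* F.arith) :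
    PreservesGeom φ := by
  refine le_antisymm
    (geom_map_le_of_eq_iInf_ker (fun l _ ψ => geom_le_ker_of_eq_iInf_ker hE.2.1 l ψ) hF.2.1 φ) ?_
  -- `Δ_F = φ(φ⁻¹(Δ_F)) ⊆ φ(Δ_E)`
  have h1 : F.geom.map φ.symm.toMulEquiv.toMonoidHom ≤ E.geom :=
    geom_map_le_of_eq_iInf_ker (fun l _ ψ => geom_le_ker_of_eq_iInf_ker hF.2.1 l ψ) hE.2.1 φ.symm
  have h2 : (F.geom.map φ.symm.toMulEquiv.toMonoidHom).map φ.toMulEquiv.toMonoidHom = F.geom := by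
    rw [Subgroup.map_map]
    have : φ.toMulEquiv.toMonoidHom.comp φ.symm.toMulEquiv.toMonoidHom = MonoidHom.id _ := by
      ext x
      exact φ.apply_symm_apply x
    rw [this, Subgroup.map_id]
  calc F.geom = (F.geom.map φ.symm.toMulEquiv.toMonoidHom).map φ.toMulEquiv.toMonoidHom := h2.symm
    _ ≤ E.geom.map φ.toMulEquiv.toMonoidHom := Subgroup.map_mono h1

/-- The same conclusion from Thm 2.6 (vi)'s first clause on the source and Thm 2.6 (i)'s
characterization on the target is only an inclusion `φ(Δ_E) ⊆ Δ_F`; recorded for mixed use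
(e.g. `E` satisfying `Thm26vi`, whose first conjunct is exactly the hypothesis `hE` of
`geom_map_le_of_eq_iInf_ker`). [cite: MochizukiAbsTopI2012, Thm 2.6 (vi) p.22] -/
theorem geom_map_le_of_thm26vi_of_thm26i (hE : E.Thm26vi) (hF : F.Thm26i)
    (φ : E.arith ≃ₜ* F.arith) : E.geom.map φ.toMulEquiv.toMonoidHom ≤ F.geom :=
  geom_map_le_of_eq_iInf_ker (fun l _ ψ => hE.1 l ψ) hF.2.1 φ

/-- COROLLARY ("`k` an FF" on both sides, via `thm26i_of_isFreeProcyclic`): for extensions `E`, `F`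
with `G_E, G_F ≅ Ẑ`, topologically finitely generated `Δ_E, Δ_F` (Prop 2.2 BY NAME) and vanishing
invariant characters ("`T_l(A)/G = 0`" for all open subgroups, GAP-LEDGER G-L4t4-1), every
isomorphism `φ : Π_E ⥲ Π_F` carries `Δ_E` onto `Δ_F`. [cite: MochizukiAbsTopI2012, Thm 2.6 (i) p.21] -/
theorem preservesGeom_of_isFreeProcyclic (hGE : IsFreeProcyclic E.gal) (hGF : IsFreeProcyclic F.gal)
    (hΔE : E.GeomTFG) (hΔF : F.GeomTFG)
    (hTE : ∀ (H : Subgroup E.arith), IsOpen (H : Set E.arith) → ∀ (l : ℕ) [Fact l.Prime]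
      (ψ : ↥(E.geom ⊓ H) →ₜ* Multiplicative ℤ_[l]),
      (∀ g ∈ H, ∀ (d d' : ↥(E.geom ⊓ H)), (d' : E.arith) = g * d * g⁻¹ → ψ d' = ψ d) →
        ∀ d, ψ d = 1)
    (hTF : ∀ (H : Subgroup F.arith), IsOpen (H : Set F.arith) → ∀ (l : ℕ) [Fact l.Prime]
      (ψ : ↥(F.geom ⊓ H) →ₜ* Multiplicative ℤ_[l]),
      (∀ g ∈ H, ∀ (d d' : ↥(F.geom ⊓ H)), (d' : F.arith) = g * d * g⁻¹ → ψ d' = ψ d) →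
        ∀ d, ψ d = 1)
    (φ : E.arith ≃ₜ* F.arith) : PreservesGeom φ :=
  preservesGeom_of_thm26i (E.thm26i_of_isFreeProcyclic hGE hΔE hTE)
    (F.thm26i_of_isFreeProcyclic hGF hΔF hTF) φ

end FundamentalExtension

end Literature.AnabelianGeometry.AbsoluteAnabelian
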